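import Summits.AnomalousDissipation.AnomalousDissipation.Theses.StirringSphere

/-!
# Birth skeleton (BC3) — crux `StirringSphere.SphereTransfer` (stmt-AnomalousDissipation-17146)

Route `route-AnomalousDissipation-StirringSphere` ("you cannot comb the stirring sphere";
`closes : NoScreening → BoundedSphereStatistics → HairyBallAlignment → SphereTransfer →
EnsembleRealization → AnomalousDissipation`), item stmt-AnomalousDissipation-17146, crux rank 4:
TRANSFER TO ONE FORCE — on the explicit 2-sphere of stirrings `f_c = c₀b₀ + c₁b₁ + c₂b₂`, `‖c‖ = 1`
(`b₀ = f_GP`, `b₁` its anti-cyclic cosine partner, `b₂` the shell-`|k|² = 2` sines), if for some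
`E, ν₀, m₀ > 0` EVERY `ν ∈ (0, ν₀)` carries a unit `c_ν` and a Foias–Prodi stationary statistical
solution `μ_ν` of `NS_ν(f_{c_ν})` with integrable mean energy `≤ E` and ensemble injection
`∫ (u, f_{c_ν}) dμ_ν ≥ m₀` (the conclusion of `HairyBallAlignment`), then `SphereEnsembleZerothLaw`:
ONE unit `c⋆` has stationary statistics `μ_j` of `NS_{ν_j}(f_{c⋆})` along `ν_j → 0` with bounded mean
energy and ensemble DISSIPATION `ν_j⟨‖∇u‖²⟩_{μ_j} ≥ ε > 0`.
Skeleton registrar planner-skel-stmt-AnomalousDissipation-17146-0, 2026-08-17 (route re-audit bin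
REPAIRABLE; `Cruxes/SphereTransfer/` had no workfile before this one; no `Disproof.lean` to honour).

## The line of this skeleton: ν-UNIFORM FORCE-EQUICONTINUITY OF ATTAINABLE INJECTION × NO ENSEMBLE
## LEAKAGE, glued by a PROVED compactness-and-tail argument on the sphere of forces (two registered stubs)

The crux hides two transfers (refuter route review 2026-08-16: "content = TWO open transfers";
planner's foreseen layer-2 split `InviscidGraph` / `EnsembleNoLeakage`), and the seam below separates
exactly them, each stated at FIXED viscosity — no inviscid-limit object appears in either stub:

* `stub_forceEquicontinuity` (THE HEART, XL; the planner's `InviscidGraph` made quantitative and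
  ν-by-ν). For every energy level `E` and tolerance `η > 0` there are `E'`, `δ > 0`, `ν₁ > 0` such
  that at EVERY `ν ∈ (0, ν₁)`, for unit `c, c'` with `‖c − c'‖ < δ`, every bounded (`≤ E`) stationary
  statistics `μ'` of `NS_ν(f_{c'})` is matched by a bounded (`≤ E'`) stationary statistics `μ` of
  `NS_ν(f_c)` losing at most `η` of injection: `∫(u, f_{c'})dμ' − η ≤ ∫(u, f_c)dμ`. In words: the
  maximal injection attainable by bounded stationary statistics is upper-semicontinuous in the force
  ALONG THE SPHERE, with a modulus UNIFORM IN THE REYNOLDS NUMBER. At each fixed `ν > 0` this holds with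
  `δ = δ(ν)` and `E' = E` (closed graph of the bounded Foias–Prodi class in the force: the statistics
  live in the ball `‖u‖ ≤ ‖f_c‖₂/(4π²ν)` — in tree, `IsStationaryStatisticalSolution.ae_norm_le` — mean
  enstrophy `≤ ‖f_c‖₂E^{1/2}/ν` gives tightness, the generator identity, the shell inequalities and the
  injection `∫(u, f_{c_n})dμ_n` pass to weak limits; nearest print: the weak-star compactness and
  closedness theory of FoiasRosaTemam2019 and the upper semicontinuity of stationary statistical
  properties under perturbation, Wang 2008 DCDS-A 23); the CONTENT is the ν-uniformity of `δ`, i.e.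
  statistical continuity in the force in the inviscid limit, restricted to a `C^∞`-compact
  3-parameter family — exactly the open species the route header declares load-bearing
  (`Literature.Barriers.AnomalousDissipation.ForceRobustNoAnomalyNarrow`, Cheskidov2023 §1.2). Why it
  might fail: a transition threshold on the sphere sharpening as `ν → 0` (bounded statistics loud at
  `c'`, all bounded statistics at the `δ`-close `c` quiet), i.e. turbulent statistics discontinuous in
  the force at infinite Reynolds number. Sources: Cheskidov2023 (arXiv:2311.04182) §1.2 Thms. 1.2–1.3;
  FMRTTurbulence2001 Ch. IV §1.2 (1.29)–(1.34); FoiasRosaTemam2019; arXiv:2207.06301.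
* `stub_noEnsembleLeakage` (the second transfer, L–XL; the planner's `EnsembleNoLeakage`, ν-by-ν).
  For every unit `c`, every `ν > 0` and every Foias–Prodi stationary statistical solution `μ` of
  `NS_ν(f_c)` (integrable energy): `∫(u, f_c)dμ ≤ ν⟨‖∇u‖²⟩_μ = ensembleDissipation ν μ` — together with
  the built-in inequality (1.31) (`IsStationaryStatisticalSolution.energy_le_holds`, in tree) this is
  the mean ENERGY EQUATION of stationary statistics of the sphere forces in dimension three. In tree
  for `d = 2` (`IsStationaryStatisticalSolution.energy_eq_holds`, a Galerkin argument inside the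
  cylindrical test class whose steps 1–3 and 5 are dimension-free); in `d = 3` the one missing input is
  the domination of the inertial term `∫(u⊗u):∇P_m u → 0`, i.e. a moment/regularity property of the
  statistics at FIXED `ν` (e.g. `∫ |u|^{1/2}‖∇u‖^{5/2} dμ < ∞`, or statistics carried by a bounded set
  of `V`) — holds for Dirac masses at steady states and their mixtures, open for diffuse statistics
  (FMRTTurbulence2001 Ch. IV §1.2: "in d = 3 only the inequality is known"). Why it might fail: a
  spurious/leaky Foias–Prodi statistics at fixed `ν` (e.g. a generalized time average of a Leray–Hopf
  flow with recurring energy defects) has injection > dissipation; then the route must be restated over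
  a leak-free class (time-average or vanishing-viscosity-limit statistics). Sources: FMRTTurbulence2001
  Ch. IV Def. 1.3, Thm. 2.2, App. B.1; FoiasRosaTemam2019; DoeringFoias2002 §2; DuchonRobert2000.

PROVED glue (`SphereTransfer_of`, ~50 lines, no `sorry`): admissible viscosities `ν_j = ν₀/(j+2)`;
`choose` the aligned loud statistics `(c_j, μ_j)` from the crux's hypothesis; Bolzano–Weierstrass on
the unit sphere of `ℝ³` (`isCompact_sphere`, `IsCompact.tendsto_subseq`) gives `c_{φ j} → c⋆`,
`‖c⋆‖ = 1`; the heart with `η = m₀/2` gives `E', δ, ν₁`, and from the tail `j ≥ N` where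
`‖c⋆ − c_{φ j}‖ < δ` and `ν_{φ j} < ν₁` (`Metric.tendsto_nhds`, `tendsto_order`, `eventually_atTop`)
bounded statistics `μ'_j` of the FIXED force `f_{c⋆}` at viscosity `ν_{φ(j+N)} → 0` with injection
`≥ m₀/2`; no-leakage turns the injection floor into the dissipation floor `ε = m₀/2`; the conclusion is
the route decl `SphereEnsembleZerothLaw` under the crux's binder `b = ![…]` (`subst`), i.e.
`StirringSphere.SphereTransfer` BY NAME.

Relations recorded (not used by the file): (1) the UNPINNED weakening of the heart ("some unit `c⋆⋆`,
not necessarily the limit point, is injection-loud along some `ν_j → 0`") composes identically but has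
no mechanism of its own; (2) a proof of `Ensemble`'s `EnsembleZerothLawAt` for any single force moots
the crux; (3) no new route, no new item: this file only registers the skeleton.

## Disproof / negatives honoured

No `Cruxes/SphereTransfer/Disproof.lean` exists (`ledger crux ls stmt-AnomalousDissipation-17146`: no
workfiles, 2026-08-17) — nothing to cite. Item evidence: grounder stamp (NEW/open; nearest print Wang
2008 Thm. 4, semigroup at fixed `ν`), refuter route-review stamp (rc 0; "two open transfers (i) force-
continuity of bounded inviscid statistics inside the fixed 3-dim family, (ii) injection floor ⇒ viscous
ensembleDissipation floor; planner's layer-2 split InviscidGraph / EnsembleNoLeakage is the right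
shape") — the two stubs ARE (i) and (ii), each cut at fixed `ν`. Negatives (`ledger negatives --problem
AnomalousDissipation`, 6 entries 2026-08-17: 14324, 0204, 13037, 2979, 2984, 2859): no stub is an
instance — the energy levels `E, E'` bound EXISTENTIALLY CHOSEN statistics on the mean-zero space `H`
(not every Leray–Hopf flow: the refuted ceilings 2979 / 2984 / 0204), and 2984's witness (Leray–Hopf data
of non-zero mean vs. mean-zero statistics) does not touch statements quantifying over statistics only.

Shape (D-0027 §3.3, as `Cruxes/NoMeanLeakage/Lines/birth.lean`): signatures `Sig.stub_<name> : Prop`,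
registered stubs `theorem stub_<name> : Sig.stub_<name> := by sorry`, composition
`SphereTransfer_of : Sig.stub_forceEquicontinuity → Sig.stub_noEnsembleLeakage → SphereTransfer`
(sorry-free) and `SphereTransfer_proof`.

References: C. Foias, O. Manley, R. Rosa, R. Temam, *Navier–Stokes Equations and Turbulence* (CUP 2001)
Ch. IV §1.2 Def. 1.3 (1.29)–(1.34), §2 Thm. 2.2, App. B.1, Ch. V §1 [FMRTTurbulence2001]; C. Foias,
R. Rosa, R. Temam, J. Dynam. Differential Equations 31 (2019) 1689–1741 [FoiasRosaTemam2019]; X. Wang,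
Discrete Contin. Dyn. Syst. 23 (2009) 521–540 (upper semi-continuity of stationary statistical
properties of dissipative systems); A. Cheskidov, arXiv:2311.04182 §1.2 [Cheskidov2023]; C. R. Doering,
C. Foias, J. Fluid Mech. 467 (2002) §2 [DoeringFoias2002]; J. Duchon, R. Robert, Nonlinearity 13 (2000)
[DuchonRobert2000]; J. Milnor, Amer. Math. Monthly 85 (1978) [Milnor1978] (the route's lever, upstream of
this crux).
-/

set_option linter.dupNamespace false

noncomputable section

namespace Summit.AnomalousDissipation.AnomalousDissipation.Cruxes.SphereTransfer.Birth

open MeasureTheory Set Filter Topology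
open Literature.Analysis Literature.Analysis.FluidPDE
open Summit.AnomalousDissipation.AnomalousDissipation.Theses.StirringSphere

local notation "𝕋³" => UnitAddTorus (Fin 3)
local notation "E³" => EuclideanSpace ℝ (Fin 3)
local notation "H³" => FunctionSpaces.Torus.energySpace (Fin 3)
local notation "L2T³" => Lp (EuclideanSpace ℝ (Fin 3)) 2 (volume : Measure (UnitAddTorus (Fin 3)))

/-! ### §0 Vocabulary of the seam (transparent abbreviations of the route's verbatim sub-terms) -/

/-- The explicit stirring basis `(b₀, b₁, b₂)` — verbatim the route's `![…]`. -/
abbrev stirBasis : Fin 3 → 𝕋³ → E³ :=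
  ![(fun x : UnitAddTorus (Fin 3) => (Literature.Analysis.FluidPDE.Torus.stokesMode (Pi.single (2 : Fin 3) (1 : ℤ)) (EuclideanSpace.single (0 : Fin 3) (1 : ℝ)) false x + Literature.Analysis.FluidPDE.Torus.stokesMode (Pi.single (0 : Fin 3) (1 : ℤ)) (EuclideanSpace.single (1 : Fin 3) (1 : ℝ)) false x + Literature.Analysis.FluidPDE.Torus.stokesMode (Pi.single (1 : Fin 3) (1 : ℤ)) (EuclideanSpace.single (2 : Fin 3) (1 : ℝ)) false x : EuclideanSpace ℝ (Fin 3))), (fun x : UnitAddTorus (Fin 3) => (Literature.Analysis.FluidPDE.Torus.stokesMode (Pi.single (1 : Fin 3) (1 : ℤ)) (EuclideanSpace.single (0 : Fin 3) (1 : ℝ)) true x + Literature.Analysis.FluidPDE.Torus.stokesMode (Pi.single (2 : Fin 3) (1 : ℤ)) (EuclideanSpace.single (1 : Fin 3) (1 : ℝ)) true x + Literature.Analysis.FluidPDE.Torus.stokesMode (Pi.single (0 : Fin 3) (1 : ℤ)) (EuclideanSpace.single (2 : Fin 3) (1 : ℝ)) true x : EuclideanSpace ℝ (Fin 3))), (fun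 x : UnitAddTorus (Fin 3) => (Literature.Analysis.FluidPDE.Torus.stokesMode ![(0 : ℤ), 1, 1] (EuclideanSpace.single (0 : Fin 3) (1 : ℝ)) false x + Literature.Analysis.FluidPDE.Torus.stokesMode ![(1 : ℤ), 0, 1] (EuclideanSpace.single (1 : Fin 3) (1 : ℝ)) false x + Literature.Analysis.FluidPDE.Torus.stokesMode ![(1 : ℤ), 1, 0] (EuclideanSpace.single (2 : Fin 3) (1 : ℝ)) false x : EuclideanSpace ℝ (Fin 3)))]

/-- The force `f_c = Σ cᵢ bᵢ` of the stirring family (verbatim the route's lambda). -/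
abbrev force (b : Fin 3 → 𝕋³ → E³) (c : E³) : 𝕋³ → E³ :=
  fun x : UnitAddTorus (Fin 3) => ∑ i : Fin 3, c i • b i x

/-- Ensemble injection `∫ (u, g) dμ(u)` of a statistics `μ` against a field `g`. -/
abbrev injection (μ : Measure H³) (g : 𝕋³ → E³) : ℝ :=
  ∫ u, Torus.pairing ((u : H³) : L2T³) g ∂μ

/-! ### §1 Signatures of the registered stubs (by name; D-0027 §3.3 shape) -/

/-- STUB 1 — **ν-UNIFORM FORCE-EQUICONTINUITY OF ATTAINABLE INJECTION ON THE SPHERE** (THE HEART, XL;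
the planner's layer-2 child `InviscidGraph`, made quantitative and stated ν-by-ν). For every energy level
`E > 0` and tolerance `η > 0` there are `E'`, `δ > 0`, `ν₁ > 0` such that for every `ν ∈ (0, ν₁)`, all
unit `c, c'` with `‖c − c'‖ < δ` and every Foias–Prodi stationary statistical solution `μ'` of
`NS_ν(f_{c'})` with integrable mean energy `≤ E`, some Foias–Prodi stationary statistical solution `μ`
of `NS_ν(f_c)` with integrable mean energy `≤ E'` has `∫(u, f_{c'})dμ' − η ≤ ∫(u, f_c)dμ`. TRUE at each
fixed `ν` with `δ = δ(ν)` (closed graph of the bounded class in the force: support bound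
`IsStationaryStatisticalSolution.ae_norm_le`, tightness from mean enstrophy `≤ ‖f‖E^{1/2}/ν`, passage of
the generator identity / shell inequalities / injection to weak limits; FoiasRosaTemam2019, Wang 2009
DCDS 23); the content is the UNIFORMITY of `δ` as `ν → 0` (statistical continuity in the force at
infinite Reynolds number inside a `C^∞`-compact 3-parameter family — the open species
`Literature.Barriers.AnomalousDissipation.ForceRobustNoAnomalyNarrow`, Cheskidov2023 §1.2). Why it might
fail: a laminar/turbulent-type transition threshold on the sphere sharpening as `ν → 0`. Sources:
Cheskidov2023 §1.2, FMRTTurbulence2001 Ch. IV §1.2, FoiasRosaTemam2019, arXiv:2207.06301. -/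
def Sig.stub_forceEquicontinuity : Prop :=
  ∀ b : Fin 3 → 𝕋³ → E³, b = stirBasis →
  ∀ E η : ℝ, 0 < E → 0 < η →
  ∃ E' δ ν₁ : ℝ, 0 < δ ∧ 0 < ν₁ ∧
    ∀ ν : ℝ, 0 < ν → ν < ν₁ →
    ∀ c c' : E³, ‖c‖ = 1 → ‖c'‖ = 1 → ‖c - c'‖ < δ →
    ∀ μ' : Measure H³,
      Torus.IsStationaryStatisticalSolution ν (force b c') μ' →
      Integrable (fun u : H³ => ‖u‖ ^ 2) μ' →
      Torus.ensembleEnergy μ' ≤ E →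
      ∃ μ : Measure H³,
        Torus.IsStationaryStatisticalSolution ν (force b c) μ ∧
        Integrable (fun u : H³ => ‖u‖ ^ 2) μ ∧
        Torus.ensembleEnergy μ ≤ E' ∧
        injection μ' (force b c') - η ≤ injection μ (force b c)

/-- STUB 2 — **NO ENSEMBLE LEAKAGE FOR THE SPHERE FORCES** (the second transfer, L–XL; the planner's
layer-2 child `EnsembleNoLeakage`, ν-by-ν). For every unit `c`, every `ν > 0` and every Foias–Prodi
stationary statistical solution `μ` of `NS_ν(f_c)` with integrable energy:
`∫(u, f_c)dμ ≤ ensembleDissipation ν μ = ν⟨‖∇u‖²⟩_μ`. With the built-in inequality FMRT IV (1.31)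
(`IsStationaryStatisticalSolution.energy_le_holds`, in tree) this is the mean ENERGY EQUATION in `d = 3`
for the sphere forces; in tree for `d = 2` (`IsStationaryStatisticalSolution.energy_eq_holds`, Galerkin
argument in the cylindrical test class, steps 1–3, 5 dimension-free), the missing 3-D input being the
domination of the inertial term `∫(u⊗u):∇P_m u → 0` — a fixed-`ν` moment/regularity property of the
statistics (e.g. `∫|u|^{1/2}‖∇u‖^{5/2}dμ < ∞`; automatic for Dirac masses at steady states and their
mixtures). Why it might fail: a leaky diffuse Foias–Prodi statistics at fixed `ν` (generalized time
average of a Leray–Hopf flow with recurring energy defects); repair = restate the route over a leak-free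
class. Sources: FMRTTurbulence2001 Ch. IV Def. 1.3, Thm. 2.2, App. B.1; FoiasRosaTemam2019;
DoeringFoias2002 §2; DuchonRobert2000. -/
def Sig.stub_noEnsembleLeakage : Prop :=
  ∀ b : Fin 3 → 𝕋³ → E³, b = stirBasis →
  ∀ c : E³, ‖c‖ = 1 → ∀ ν : ℝ, 0 < ν →
  ∀ μ : Measure H³,
    Torus.IsStationaryStatisticalSolution ν (force b c) μ →
    Integrable (fun u : H³ => ‖u‖ ^ 2) μ →
    injection μ (force b c) ≤ Torus.ensembleDissipation ν μ

/-! ### §2 Registered stubs (the only `sorry`s of the file) -/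

/-- Registered stub 1 — ν-uniform force-equicontinuity of attainable injection (the heart; hardest). -/
theorem stub_forceEquicontinuity : Sig.stub_forceEquicontinuity := by
  sorry

/-- Registered stub 2 — no ensemble leakage for the sphere forces (3-D energy equation of stationary
statistics at fixed `ν`). -/
theorem stub_noEnsembleLeakage : Sig.stub_noEnsembleLeakage := by
  sorry

/-! ### §3 Composition (kernel-checked; no `sorry` outside the two stubs) -/

/-- **The skeleton closes the crux BY NAME**: `Sig.stub_forceEquicontinuity → Sig.stub_noEnsembleLeakage →
StirringSphere.SphereTransfer`. Admissible viscosities `ν_j = ν₀/(j+2) ∈ (0, ν₀)`, `ν_j → 0`; the crux's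
hypothesis gives aligned loud bounded statistics `(c_j, μ_j)`; Bolzano–Weierstrass on the unit sphere of
`ℝ³` gives `c_{φ j} → c⋆`; the heart with `η = m₀/2` and the tail `j ≥ N` (`‖c⋆ − c_{φ j}‖ < δ`,
`ν_{φ j} < ν₁`) give bounded statistics of the FIXED force `f_{c⋆}` at viscosities `ν_{φ(j+N)} → 0` with
injection `≥ m₀/2`; no-leakage makes `ε = m₀/2` a dissipation floor; `subst` along `b' = b` turns this
into the route decl `SphereEnsembleZerothLaw`, i.e. the crux. -/
theorem SphereTransfer_of :
    Sig.stub_forceEquicontinuity → Sig.stub_noEnsembleLeakage → SphereTransfer := by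
  intro hA hB b hb E ν₀ m₀ hE hν₀ hm₀ hal
  -- (1) a sequence of admissible viscosities `νs j = ν₀ / (j + 2) ∈ (0, ν₀)`, `νs → 0`
  set νs : ℕ → ℝ := fun j => ν₀ / ((j : ℝ) + 2) with hνs_def
  have hνs_pos : ∀ j, 0 < νs j := fun j => by positivity
  have hνs_lt : ∀ j, νs j < ν₀ := fun j => by
    have h2 : (1 : ℝ) < (j : ℝ) + 2 := by
      have := (Nat.cast_nonneg j : (0 : ℝ) ≤ j); linarith
    exact div_lt_self hν₀ h2
  have hνs_tend : Tendsto νs atTop (𝓝 0) :=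
    tendsto_const_nhds.div_atTop (tendsto_natCast_atTop_atTop.atTop_add tendsto_const_nhds)
  -- (2) aligned loud bounded statistics at every `νs j` (the crux's hypothesis)
  choose c μ hc hstat hint hEn hinj using fun j => hal (νs j) (hνs_pos j) (hνs_lt j)
  -- (3) compactness of the unit sphere of `ℝ³`: `c (φ j) → cstar`
  obtain ⟨cstar, hcstar_mem, φ, hφ, hcφ⟩ :=
    (isCompact_sphere (0 : E³) 1).tendsto_subseq (x := c) (fun j => mem_sphere_zero_iff_norm.2 (hc j))
  have hcstar : ‖cstar‖ = 1 := mem_sphere_zero_iff_norm.1 hcstar_mem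
  -- (4) the ν-uniform modulus of force-continuity with `η = m₀ / 2`
  obtain ⟨E', δ, ν₁, hδ, hν₁, hmod⟩ := hA b hb E (m₀ / 2) hE (half_pos hm₀)
  have ev₁ : ∀ᶠ j in atTop, dist (c (φ j)) cstar < δ := Metric.tendsto_nhds.1 hcφ δ hδ
  have ev₂ : ∀ᶠ j in atTop, νs (φ j) < ν₁ :=
    (tendsto_order.1 (hνs_tend.comp hφ.tendsto_atTop)).2 ν₁ hν₁
  obtain ⟨N, hN⟩ := eventually_atTop.1 (ev₁.and ev₂)
  -- (5) loud bounded statistics of the FIXED force `f_{cstar}` at the viscosities `νs (φ (j + N))`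
  have key : ∀ j : ℕ, ∃ μ' : Measure H³,
      Torus.IsStationaryStatisticalSolution (νs (φ (j + N))) (force b cstar) μ' ∧
      Integrable (fun u : H³ => ‖u‖ ^ 2) μ' ∧
      Torus.ensembleEnergy μ' ≤ E' ∧
      m₀ / 2 ≤ injection μ' (force b cstar) := by
    intro j
    obtain ⟨h₁, h₂⟩ := hN (j + N) (Nat.le_add_left N j)
    have hdist : ‖cstar - c (φ (j + N))‖ < δ := by
      rwa [← dist_eq_norm, dist_comm]
    obtain ⟨μ', hs, hi, he, hinj'⟩ := hmod (νs (φ (j + N))) (hνs_pos _) h₂ cstar (c (φ (j + N)))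
      hcstar (hc _) hdist (μ (φ (j + N))) (hstat _) (hint _) (hEn _)
    refine ⟨μ', hs, hi, he, ?_⟩
    have h0 : m₀ ≤ injection (μ (φ (j + N))) (force b (c (φ (j + N)))) := hinj (φ (j + N))
    linarith
  choose μ' hs' hi' he' hinj' using key
  -- (6) no ensemble leakage turns the injection floor into a dissipation floor: the target
  intro b' hb'
  have hbb : b' = b := hb'.trans hb.symm
  subst hbb
  refine ⟨cstar, hcstar, fun j => νs (φ (j + N)), μ', fun j => hνs_pos _, ?_, hs', hi', ⟨E', he'⟩,
    m₀ / 2, half_pos hm₀, fun j => ?_⟩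
  · exact (hνs_tend.comp hφ.tendsto_atTop).comp (tendsto_add_atTop_nat N)
  · exact (hinj' j).trans (hB b' hb cstar hcstar _ (hνs_pos _) _ (hs' j) (hi' j))

/-- The skeleton in its final shape (D-0027 §3.3): the crux BY NAME from the two registered stubs; it
becomes the crux proof when the last `stub_*` is discharged (until then it depends on `sorryAx` through
the stubs only — no `sorry` of its own). -/
theorem SphereTransfer_proof : SphereTransfer :=
  SphereTransfer_of stub_forceEquicontinuity stub_noEnsembleLeakage

end Summit.AnomalousDissipation.AnomalousDissipation.Cruxes.SphereTransfer.Birth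

end
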